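import Literature.NumberTheory.LFunctions.Zhang2022.KnifeEdgeLenZDegreePsi
import Literature.NumberTheory.LFunctions.Zhang2022.Section4Prop22Eventually

/-!
# Zhang (2022), rung F-S3 (Landau–Siegel programme, §D edge len = E*-len⁺): card `z-degree-toeplitz-band` — the graded
# endgames CLOSED (Part-I claims discharged by the tree: `Skeleton.prop22i_holds`, `Skeleton.lemma23_eventually`), i.e.
# the route-glue heads whose ONLY hypotheses are the card's own slots and its closing alternative (PROVED; nothing asserted)

Y. Zhang, *Discrete mean estimates and the Landau–Siegel zero*, arXiv:2211.02515v1 [Zhang2022LandauSiegel] —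
an unrefereed manuscript under adjudication. **WHAT THIS IS NOT: not a claim about Theorems 1–2 of
arXiv:2211.02515, about Landau–Siegel zeros, or about Parity. The programme SEARCHES and TYPES; no claim about
Landau–Siegel zeros, Theorems 1–2 of arXiv:2211.02515 or a repaired Margin232 until a kernel theorem says so.
Every `theorem` below is an implication from the bare slot `Prop`s of `KnifeEdgeLenZDegree` / `KnifeEdgeLenZDegreePsi` /
`KnifeEdgeGramEndgame` (asserted by no one) to the skeleton's `Theorem1`/`Theorem2`; the Part-I inputs `Prop22i`,
`Lemma23 c′` are no longer hypotheses because the tree PROVES them (`Skeleton.prop22i_holds`,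
`Skeleton.lemma23_eventually : ∃ c₀ ≥ 0, ∀ c′ ≥ c₀, Lemma23 c′`, Section4Prop22Eventually).**

Companion BY NAME of `KnifeEdgeEndgameClosed` (the N12 closed-twin list, which names the §D len endgames as «live authors'
call»): the closed twins of `theorem1_of_gramSlots` (generic Gram endgame), `theorem1_of_gradedCloses` (`Z(·,χψ)`-grading)
and `theorem1_of_gradedClosesPsi` (`Z(·,ψ)`-grading — the primary line K1″ after the author's R1), in the N12 shape
`∃ c₀ ≥ 0, ∀ c′ ≥ c₀, slots(c′) → closing → Theorem1`, plus the GLUE-READY forms whose binders are the slots for every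
`c′ ≥ 0` (the shape a route's `closes` consumes: cruxes only). Cell landau-siegel §D, BIRTH (4) (director-frontier
2026-08-27T01:42:55Z; author ls-knife-len-idea-1, typer ls-knife-typer-1).

## References
* Y. Zhang, arXiv:2211.02515v1 (2022), §1 Theorems 1–2; §2 p. 6, Lemma 2.3, Prop. 2.2 (i). [cite: Zhang2022LandauSiegel, §1, §2 Lemma 2.3, Prop. 2.2]
-/

noncomputable section

open Complex Real ComplexConjugate

namespace Literature.NumberTheory.LFunctions.Zhang2022.KnifeEdge

open Repair Skeleton

/-! ### Part 1 — the generic Gram endgame, closed -/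

/-- **Generic Gram endgame, CLOSED (N12 shape):** for every sufficiently large `c′`, entry slots for a finite family of
tables and an amplitude vector with negative main quadratic form refute (A) eventually — Prop. 2.2 (i) and Lemma 2.3
supplied by the tree. [cite: Zhang2022LandauSiegel, §2 p. 6, Lemma 2.3, Prop. 2.2 (i)] -/
theorem eventually_not_assumptionA_of_gramSlots_closed {ι : Type*} [Fintype ι] :
    ∃ c₀ : ℝ, 0 ≤ c₀ ∧ ∀ c' : ℝ, c₀ ≤ c' → ∀ {U : ι → DTable} {M : ι → ι → ℂ},
      (∀ a b, GramEntryAsymp c' (U a) (U b) (M a b)) → ∀ {x : ι → ℂ},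
      (∑ a, ∑ b, x a * conj (x b) * M a b).re < 0 →
      ∃ D₀ : ℕ, ∀ (D : ℕ) [NeZero D] (χ : DirichletCharacter ℂ D),
        D₀ ≤ D → χ.IsQuadratic → χ.IsPrimitive → ¬ AssumptionA D χ := by
  obtain ⟨c₀, h0, h⟩ := lemma23_eventually
  exact ⟨c₀, h0, fun c' hc' _ _ hs _ hneg => eventually_not_assumptionA_of_gramSlots hs hneg prop22i_holds (h c' hc')⟩

/-- **… hence Theorem 1, CLOSED.** [cite: Zhang2022LandauSiegel, §1 Theorem 1] -/
theorem theorem1_of_gramSlots_closed {ι : Type*} [Fintype ι] :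
    ∃ c₀ : ℝ, 0 ≤ c₀ ∧ ∀ c' : ℝ, c₀ ≤ c' → ∀ {U : ι → DTable} {M : ι → ι → ℂ},
      (∀ a b, GramEntryAsymp c' (U a) (U b) (M a b)) → ∀ {x : ι → ℂ},
      (∑ a, ∑ b, x a * conj (x b) * M a b).re < 0 → Theorem1 := by
  obtain ⟨c₀, h0, h⟩ := lemma23_eventually
  exact ⟨c₀, h0, fun c' hc' _ _ hs _ hneg => theorem1_of_gramSlots hs hneg prop22i_holds (h c' hc')⟩

/-- **Glue-ready form:** slots for EVERY `c′ ≥ 0` and a negative direction ⇒ Theorem 1 (instantiate at the tree's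
threshold). [cite: Zhang2022LandauSiegel, §1 Theorem 1] -/
theorem theorem1_of_gramSlots_allC {ι : Type*} [Fintype ι] {U : ι → DTable} {M : ι → ι → ℂ}
    (hs : ∀ c' : ℝ, 0 ≤ c' → ∀ a b, GramEntryAsymp c' (U a) (U b) (M a b)) {x : ι → ℂ}
    (hneg : (∑ a, ∑ b, x a * conj (x b) * M a b).re < 0) : Theorem1 := by
  obtain ⟨c₀, h0, h⟩ := theorem1_of_gramSlots_closed (ι := ι)
  exact h c₀ le_rfl (hs c₀ h0) hneg

/-! ### Part 2 — the `Z(·,χψ)`-graded endgame, closed -/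

section Chi

variable {X₁ Y₁ X₂ : PairFunctional}

/-- **`theorem1_of_gradedCloses`, CLOSED (N12 shape).** [cite: Zhang2022LandauSiegel, §1 Theorem 1, §2 p. 6] -/
theorem theorem1_of_gradedCloses_closed :
    ∃ c₀ : ℝ, 0 ≤ c₀ ∧ ∀ c' : ℝ, c₀ ≤ c' → ∀ X₁ Y₁ X₂ : PairFunctional,
      InClassMean c' → CrossTable c' 1 X₁ → DualCrossTable c' 1 Y₁ → TauTwoTable c' X₂ →
      GradedCloses X₁ Y₁ X₂ → Theorem1 := by
  obtain ⟨c₀, h0, h⟩ := lemma23_eventually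
  exact ⟨c₀, h0, fun c' hc' _ _ _ h0' h1 h21 h2 hC =>
    theorem1_of_gradedCloses h0' h1 h21 h2 hC prop22i_holds (h c' hc')⟩

/-- **Glue-ready form** (slots for every `c′ ≥ 0`). [cite: Zhang2022LandauSiegel, §1 Theorem 1] -/
theorem theorem1_of_gradedCloses_allC (h0 : ∀ c' : ℝ, 0 ≤ c' → InClassMean c')
    (h1 : ∀ c' : ℝ, 0 ≤ c' → CrossTable c' 1 X₁) (h21 : ∀ c' : ℝ, 0 ≤ c' → DualCrossTable c' 1 Y₁)
    (h2 : ∀ c' : ℝ, 0 ≤ c' → TauTwoTable c' X₂) (hC : GradedCloses X₁ Y₁ X₂) : Theorem1 := by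
  obtain ⟨c₀, hc0, h⟩ := theorem1_of_gradedCloses_closed
  exact h c₀ le_rfl X₁ Y₁ X₂ (h0 c₀ hc0) (h1 c₀ hc0) (h21 c₀ hc0) (h2 c₀ hc0) hC

/-- … and Theorem 2. [cite: Zhang2022LandauSiegel, §1 Theorem 2] -/
theorem theorem2_of_gradedCloses_allC (h0 : ∀ c' : ℝ, 0 ≤ c' → InClassMean c')
    (h1 : ∀ c' : ℝ, 0 ≤ c' → CrossTable c' 1 X₁) (h21 : ∀ c' : ℝ, 0 ≤ c' → DualCrossTable c' 1 Y₁)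
    (h2 : ∀ c' : ℝ, 0 ≤ c' → TauTwoTable c' X₂) (hC : GradedCloses X₁ Y₁ X₂) : Theorem2 :=
  Skeleton.theorem2_of_theorem1 (theorem1_of_gradedCloses_allC h0 h1 h21 h2 hC)

end Chi

/-! ### Part 3 — the `Z(·,ψ)`-graded endgame (primary line K1″ after R1), closed -/

section Psi

variable {X₁ Y₁ X₂ : PairFunctional}

/-- **`theorem1_of_gradedClosesPsi`, CLOSED (N12 shape):** for every sufficiently large `c′`, the side tables, the
ψ-graded degree-1 tables, the ψ-graded degree-2 table (K1″'s `X₂`) and a non-PSD design give Theorem 1 — no Part-I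
hypothesis left. [cite: Zhang2022LandauSiegel, §1 Theorem 1, §2 p. 6] -/
theorem theorem1_of_gradedClosesPsi_closed :
    ∃ c₀ : ℝ, 0 ≤ c₀ ∧ ∀ c' : ℝ, c₀ ≤ c' → ∀ X₁ Y₁ X₂ : PairFunctional,
      InClassMean c' → CrossTablePsi c' 1 X₁ → DualCrossTablePsi c' 1 Y₁ → TauTwoTablePsi c' X₂ →
      GradedCloses X₁ Y₁ X₂ → Theorem1 := by
  obtain ⟨c₀, h0, h⟩ := lemma23_eventually
  exact ⟨c₀, h0, fun c' hc' _ _ _ h0' h1 h21 h2 hC =>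
    theorem1_of_gradedClosesPsi h0' h1 h21 h2 hC prop22i_holds (h c' hc')⟩

/-- **GLUE HEAD for BIRTH (4) (slots for every `c′ ≥ 0`):** `InClassMean`, `CrossTablePsi 1 X₁`, `DualCrossTablePsi 1 Y₁`,
`TauTwoTablePsi X₂` (each for all `c′ ≥ 0`) ∧ `GradedCloses X₁ Y₁ X₂` ⇒ `Skeleton.Theorem1`. Every binder is one of the
card's own OPEN slots / its closing alternative; nothing else. [cite: Zhang2022LandauSiegel, §1 Theorem 1] -/
theorem theorem1_of_gradedClosesPsi_allC (h0 : ∀ c' : ℝ, 0 ≤ c' → InClassMean c')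
    (h1 : ∀ c' : ℝ, 0 ≤ c' → CrossTablePsi c' 1 X₁) (h21 : ∀ c' : ℝ, 0 ≤ c' → DualCrossTablePsi c' 1 Y₁)
    (h2 : ∀ c' : ℝ, 0 ≤ c' → TauTwoTablePsi c' X₂) (hC : GradedCloses X₁ Y₁ X₂) : Theorem1 := by
  obtain ⟨c₀, hc0, h⟩ := theorem1_of_gradedClosesPsi_closed
  exact h c₀ le_rfl X₁ Y₁ X₂ (h0 c₀ hc0) (h1 c₀ hc0) (h21 c₀ hc0) (h2 c₀ hc0) hC

/-- … and Theorem 2. [cite: Zhang2022LandauSiegel, §1 Theorem 2] -/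
theorem theorem2_of_gradedClosesPsi_allC (h0 : ∀ c' : ℝ, 0 ≤ c' → InClassMean c')
    (h1 : ∀ c' : ℝ, 0 ≤ c' → CrossTablePsi c' 1 X₁) (h21 : ∀ c' : ℝ, 0 ≤ c' → DualCrossTablePsi c' 1 Y₁)
    (h2 : ∀ c' : ℝ, 0 ≤ c' → TauTwoTablePsi c' X₂) (hC : GradedCloses X₁ Y₁ X₂) : Theorem2 :=
  Skeleton.theorem2_of_theorem1 (theorem1_of_gradedClosesPsi_allC h0 h1 h21 h2 hC)

/-- **The X₂ = 0 (τ₂ dark) horn, closed:** slots (with `TauTwoTablePsi c′ 0`) and ONE in-class triple violating the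
tridiagonal Schur bound (`𝔅f, 𝔅g₂ > 0`, `𝔅g₁ < |X₁|²/𝔅f + |Y₁|²/𝔅g₂`) ⇒ Theorem 1 (`gradedCloses_dark_of_schur`).
[cite: Zhang2022LandauSiegel, §1 Theorem 1, §2 (2.16)] -/
theorem theorem1_of_schur_dark_allC (h0 : ∀ c' : ℝ, 0 ≤ c' → InClassMean c')
    (h1 : ∀ c' : ℝ, 0 ≤ c' → CrossTablePsi c' 1 X₁) (h21 : ∀ c' : ℝ, 0 ≤ c' → DualCrossTablePsi c' 1 Y₁)
    (h2 : ∀ c' : ℝ, 0 ≤ c' → TauTwoTablePsi c' 0) {f f' g₁ g₁' g₂ g₂' : ℝ → ℂ}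
    (hf : InClassPiece f f') (hg₁ : InClassPiece g₁ g₁') (hg₂ : InClassPiece g₂ g₂')
    (hB0 : 0 < mainTermForm f f') (hB2 : 0 < mainTermForm g₂ g₂')
    (hlt : mainTermForm g₁ g₁' < ‖X₁ f f' g₁ g₁'‖ ^ 2 / mainTermForm f f' + ‖Y₁ g₁ g₁' g₂ g₂'‖ ^ 2 / mainTermForm g₂ g₂') :
    Theorem1 :=
  theorem1_of_gradedClosesPsi_allC h0 h1 h21 h2 (gradedCloses_dark_of_schur hf hg₁ hg₂ hB0 hB2 hlt)

end Psi

end Literature.NumberTheory.LFunctions.Zhang2022.KnifeEdge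

end
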